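import Summits.QuantumFields.BalabanUV.T4Continuum.Support.TermwiseLocalBinders
import Summits.QuantumFields.BalabanUV.T4Continuum.Support.TermwiseLevelsLedger

/-!
# TermwiseLocalLedger — (U)(L) for `U(N)` Wilson terms PRODUCED from LEVEL-GRADED LOCAL regularity under the window
clause, and the term-wise ledger theorem called ONCE: `GoodClause ∧ Summable δ⁗` for the I-3 good class's action kind
with Bałaban's concrete one-step average, every `N`

Cell `pub-balaban`, rung (B)+1 sub-cell t4, lineage `b2b-balaban-t4-ne7-p1` (node U5 = NE7, TERM-WISE member;
generation 17), record `t4/T4-EST-NE7-P1.md` §22; companions `Support/TermwiseLocal(Binders)`,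
`Support/TermwiseLevels(Ledger)`.  HONEST FRAMING (page 1): FIXED FINITE T⁴, rung (B)+1 = the `ε → 0` limit of
unit-scale averaged expectations, CONDITIONAL on BetaPertH and the nine spine estimates (0/9 proved); NOT infinite
volume, NOT a mass gap, NOT the Clay problem.  NE7 is NOT PRINTED in [Balaban1984PropagatorsI]–[Balaban1989LargeFieldII]
and NOT proved here: every estimate below is a HYPOTHESIS BINDER named in the statement; the flow window (0.31) of
[Balaban1987RG1] enters BY NAME as `h031A`/`h031B`; (B)/(B^μ) sit by name inside the producers of the upstream ledger
kinds; nothing is hidden in a definition.  [folklore] bookkeeping; no definitions, no cite tags; nothing printed is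
asserted.

WHAT IS PROVED ([folklore]).
§5 **`interpolation_averaging_UN_levels`** — `T4TermwiseChainUN.interpolation_averaging_UN` (generation 13: `V = u(N)`,
   `e = eN`, `q₄ = N/24`, Bałaban's average (42) through `pker`/`PhiU`/`psiU`/`phiU` on the tower of tori
   `M·L^{K+1}`) RE-KEYED to LEVEL-GRADED LOCAL hypotheses, as ONE CALL of
   `TermwiseLevels.interpolation_averaging_of_levels` with `sz_j = 2α_j`, `ω_j = 16L·α₁,j`, `ρb_j = 280(320L²α_j)²`:
   (wt)(ker)(cnt)(tr) discharged as in generation 13; (bch-U)(bch-L) by `bch_PhiU_local`, (sz-U)(sz-L) by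
   `norm_phiU_le_window_local`, (sz-Lf) by `norm_phiU_le_local`, (osc-U) by `norm_PhiU_sub_PhiU_local`, (scal) per
   level by generation 12/13's `size_le_of_decay`, `rho_le_of_decay` and the (44∇) law.  OUTPUT: generation 9's six
   binders with `dU_K = #planes·cU(N/24, cSZ, cOSC, cBCH, ε₁)·windowSum L⁻² L⁴ (jlogOf Cl K) K` and
   `dL_K = #planes·C_L·windowSum L⁻² L⁴ (jlogOf Cl K) K`, non-negative and summable.
§6 **`goodClause_summable_UN_levels`** — ONE CALL of generation 9's `goodClause_summable_of_kindsRA_lift` with §5's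
   output (and `hMvol : M⁴ ≤ vol` as in generation 13).

BINDER CENSUS of §6 (every one a hypothesis; which are estimates).  As `T4TermwiseChainUN.goodClause_summable_UN` —
all of generation 9's ledger binders VERBATIM ((T)(B-T)(R-T)(F)(F′)(S)(M)(M-B)(B-adm)(B-win)(N)(Q)(R-sc)(M-R)(R-S)
(0.31)(min-A)(Q)(lift)(min-B)(act)(γ)(R-w)(W-w)), (repr) `hreprU hreprL`, `hMvol`, `hcα hε₁`, `2 ≤ M`, `2 ≤ L`,
genuine planes — with the UNIFORM background axioms replaced by:
(lvl) `lvlA lvlB lvlBf` — the regularity LEVEL MAPS on the window labels `pbox planes (M·L^K)` (lift of run A's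
  background; run B's background) and on the fine labels `pbox planes (M·L^{K+1})` (run B): DATA of the history
  (which window lies in which domain `Ω_j ∖ Ω_{j+1}`; nodes U5a/U5c), not estimated;
(win) `hwinA hwinB hwinBf` — THE WINDOW CLAUSE `RecentOnly (pbox …) (lvl· K t τ v) (jlogOf Cl K) K`, the SAME cut as
  the boundary kind's (B-win) `hBwin`: interface I-3 of the cell = a DEFINITION of the bad class (older pending
  structure ⇒ `Bad K t`, weight half NE7b), NOT PRINTED, not an estimate;
(44-loc) `hA hB` — unitarity, `M·L^{K+1}`-periodicity, and `|V(∂p) − 1| ≤ αlev (lvl y)` for the unit plaquettes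
  `p ⊂ Δ(p′_y)` of EVERY window `y` (LOCATED in shape: [Balaban1985Variational] conditions (2) p. 278 «for p ∈ Ω_j»,
  one run; [Balaban1989LargeFieldII] p. 361 for multi-domain backgrounds; asked for BOTH runs' backgrounds and the
  lift: ESTIMATES); `hBf` — the same at each fine plaquette of run B with `αlev (lvlBf x)`;
(44∇-loc) `hAosc` — the one-bond covariant oscillation of `log V_A(∂p)` on the bonds of `Δ(p′_y)` is
  `≤ α₁lev (lvlA y)` (NOT PRINTED; the binder that carries the rate; ESTIMATE);
(scal) `hαlev` (`0 ≤ α_j`, `20480·L²·α_j ≤ 1` at every level), `hdecay` (`α_j ≤ c_α ε₁ L^{−2j}`, (B)-type INPUT per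
  level), `hα₁lev` (`0 ≤ α₁,j ≤ c_{α1} ε₁ L^{−2(j+1)} L^{−j}`, (B∇)-type INPUT per level); `hCl : 0 ≤ Cl`.
OUTPUT: the good clause with `δ⁗_K` explicit — action share `w₀·(dU_K + dL_K)` windowed as in §5 — and `Summable δ⁗`.

WHAT THIS CLOSES / WHAT IT DOES NOT.  Record (20l)(γ)(i) (level-graded producers of generations 11–13, per window):
DONE for Bałaban's concrete average and `G = U(N)`, modulo the per-window inputs (44-loc)/(44∇-loc).  Generations
14–16's reduction of (44)/(44∇) to ONE local regularity binder (`LocReg`/`HolderReg` → the tree's typed B11 Theorem 1)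
is stated per SITE with uniform constants; re-keying it per window is the remaining plumbing step, NOT done here.  NOT
DELIVERED: the level maps; any instantiation on Bałaban's minimisers; (repr); (0.31); the upstream kinds; the W-D
island clause; anything about print.  Value = the ledger accepts Bałaban's one-step average with LEVEL-GRADED LOCAL
regularity under the displayed window clause; NOT NE7, NOT summit progress.

References (LOCATIONS only): as in `Support/TermwiseLocalBinders` and `Support/TermwiseLevelsLedger`.
-/

noncomputable section

open Finset MeasureTheory _root_.Filter _root_.Topology
open scoped BigOperators Matrix.Norms.L2Operator

namespace Summit.QuantumFields.BalabanUV.T4Continuum.TermwiseLocal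

open Literature.MathematicalPhysics.QuantumFieldTheory.Balaban1983to89
open T4OutputRate T4RecentScale T4GoodClassBudget T4CauchySum T4Crossover T4TowerRateComposition T4TowerRateDischarge
open T4BoundaryCarrier (BFunctional atFl NE9Fl LipBackgroundFl NE5B)
open T4TermwiseBudget T4TermwiseDeviation T4TermwiseCurrency T4TermwiseBoundary T4TermwiseResidual T4TermwiseAction
open T4TermwiseClassical T4TermwiseQuartic
open T4TermwiseInstantiate (cBCH cBCH_nonneg rho_le_of_decay cSZ cSZ_nonneg half_of_smallness size_le_of_decay)
open T4TermwiseOscillation (cOSC)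
open B7Prop1Explicit B7Prop2Explicit B7Prop1Local T4TermwiseBCH T4TermwiseTorus T4TermwiseUN T4TermwiseChainUN
open TermwiseHeterogeneous (cU)
open TermwiseLevels (interpolation_averaging_of_levels)
/-! ## §5 (U)(L) for `U(N)` Wilson terms PRODUCED from LEVEL-GRADED LOCAL regularity under the window clause -/

section Capstone
variable {n : Type*} [Fintype n] [DecidableEq n] [Nonempty n]
variable {ι : Type} {σ : Type*} [DecidableEq σ] {l₀ : ℝ} {T : ℕ → Finset σ} {Bad : ℕ → ℝ → Finset σ} {Adm : Set ι}

/-- **(U)(L) FOR `U(N)` WILSON TERMS FROM LEVEL-GRADED LOCAL REGULARITY — ONE CALL of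
`TermwiseLevels.interpolation_averaging_of_levels`** with generation 13's dictionary (`V = u(N)`, `e = eN`,
`q₄ = N/24`, `pbox`/`pker`/`phiU`/`psiU`/`PhiU`, `n₀ = #planes`, `vol = M⁴`, `c₁ = cSZ`, `c₂ = cOSC`, `c₃ = cBCH`) and
the LEVEL-GRADED radii `sz_j = 2α_j`, `ω_j = 16L·α₁,j`, `ρb_j = 280(320L²α_j)²`: (wt)(ker)(cnt)(tr) discharged as in
generation 13; (bch) by `bch_PhiU_local`, (sz) by `norm_phiU_le_window_local` / `norm_phiU_le_local`, (osc-U) by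
`norm_PhiU_sub_PhiU_local` — each from the LOCAL hypothesis on `Δ(p′_y)` AT THE WINDOW'S LEVEL.  REMAINING
hypotheses, BY NAME: level maps `lvlA lvlB lvlBf`, window clauses `hwinA hwinB hwinBf`, unitarity + periodicity +
LOCAL (44) `hA hB hBf`, LOCAL (44∇) `hAosc`, per-level smallness `hαlev` and decays `hdecay` `hα₁lev` ((B)/(B∇)-type
INPUTS per level), (repr) `hreprU hreprL`, `hcα hε₁ hCl`, `2 ≤ M`, `2 ≤ L`, genuine planes.  OUTPUT: generation 9's
six binders with `dU_K = #planes·C_U·windowSum L⁻² L⁴ (jlogOf Cl K) K`, `dL_K = #planes·C_L·(same)`. [folklore] -/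
theorem interpolation_averaging_UN_levels {Y YA : Type*} {g : ℕ → ℝ → σ → ι → YA → ℝ}
    {f₁ : ℕ → ℝ → σ → ι → Y → ℝ} {Q : ℕ → ℝ → σ → ι → Y → YA} {yA yB : ℕ → ℝ → σ → ι → Y}
    {xA : ℕ → ℝ → σ → ι → YA}
    (M L : ℕ) (hM : 2 ≤ M) (hL : 2 ≤ L) (planes : Finset (Fin 4 × Fin 4)) (hplanes : ∀ P ∈ planes, P.1 ≠ P.2)
    (VA VB : ℕ → ℝ → σ → ι → (B7Prop1Explicit.Site 4 → Fin 4 → (Matrix n n ℂ)ˣ))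
    (lvlA lvlB lvlBf : ℕ → ℝ → σ → ι → (Fin 4 × Fin 4) × B7Prop1Explicit.Site 4 → ℕ)
    {αlev α₁lev : ℕ → ℝ} {cα cα₁ ε₁ Cl : ℝ}
    (hαlev : ∀ j, 0 ≤ αlev j ∧ 20480 * (L : ℝ) ^ 2 * αlev j ≤ 1)
    (hA : ∀ K t, |t| ≤ l₀ → ∀ τ ∈ T K \ Bad K t, ∀ v ∈ Adm,
      (∀ x κ, VA K t τ v x κ ∈ unitaryUnits (Matrix n n ℂ)) ∧ IsPeriodic (M * L ^ K * L) (VA K t τ v) ∧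
        ∀ y ∈ pbox planes (M * L ^ K), ∀ (x : B7Prop1Explicit.Site 4) (κ κ' : Fin 4), κ ≠ κ' →
          PlaqIn ((L : ℤ) • y.2) (deltaHi L ((L : ℤ) • y.2) y.1.1 y.1.2) (x, κ, κ') →
          ‖((hol (VA K t τ v) x (plaqWord κ κ') : (Matrix n n ℂ)ˣ) : Matrix n n ℂ) - 1‖ ≤ αlev (lvlA K t τ v y))
    (hB : ∀ K t, |t| ≤ l₀ → ∀ τ ∈ T K \ Bad K t, ∀ v ∈ Adm,
      (∀ x κ, VB K t τ v x κ ∈ unitaryUnits (Matrix n n ℂ)) ∧ IsPeriodic (M * L ^ K * L) (VB K t τ v) ∧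
        ∀ y ∈ pbox planes (M * L ^ K), ∀ (x : B7Prop1Explicit.Site 4) (κ κ' : Fin 4), κ ≠ κ' →
          PlaqIn ((L : ℤ) • y.2) (deltaHi L ((L : ℤ) • y.2) y.1.1 y.1.2) (x, κ, κ') →
          ‖((hol (VB K t τ v) x (plaqWord κ κ') : (Matrix n n ℂ)ˣ) : Matrix n n ℂ) - 1‖ ≤ αlev (lvlB K t τ v y))
    (hBf : ∀ K t, |t| ≤ l₀ → ∀ τ ∈ T K \ Bad K t, ∀ v ∈ Adm, ∀ x ∈ pbox planes (M * L ^ K * L),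
      ‖((hol (VB K t τ v) x.2 (plaqWord x.1.1 x.1.2) : (Matrix n n ℂ)ˣ) : Matrix n n ℂ) - 1‖ ≤ αlev (lvlBf K t τ v x))
    (hAosc : ∀ K t, |t| ≤ l₀ → ∀ τ ∈ T K \ Bad K t, ∀ v ∈ Adm, ∀ y ∈ pbox planes (M * L ^ K),
      ∀ (z : B7Prop1Explicit.Site 4) (κ : Fin 4), InBox ((L : ℤ) • y.2) (deltaHi L ((L : ℤ) • y.2) y.1.1 y.1.2) z →
        InBox ((L : ℤ) • y.2) (deltaHi L ((L : ℤ) • y.2) y.1.1 y.1.2) (z + e κ) →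
        ‖((VA K t τ v z κ : (Matrix n n ℂ)ˣ) : Matrix n n ℂ) * phiM (VA K t τ v) y.1 (z + e κ)
            * (((VA K t τ v z κ)⁻¹ : (Matrix n n ℂ)ˣ) : Matrix n n ℂ) - phiM (VA K t τ v) y.1 z‖
          ≤ α₁lev (lvlA K t τ v y))
    (hwinA : ∀ K t, |t| ≤ l₀ → ∀ τ ∈ T K \ Bad K t, ∀ v ∈ Adm,
      RecentOnly (pbox planes (M * L ^ K)) (lvlA K t τ v) (jlogOf Cl K) K)
    (hwinB : ∀ K t, |t| ≤ l₀ → ∀ τ ∈ T K \ Bad K t, ∀ v ∈ Adm,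
      RecentOnly (pbox planes (M * L ^ K)) (lvlB K t τ v) (jlogOf Cl K) K)
    (hwinBf : ∀ K t, |t| ≤ l₀ → ∀ τ ∈ T K \ Bad K t, ∀ v ∈ Adm,
      RecentOnly (pbox planes (M * L ^ K * L)) (lvlBf K t τ v) (jlogOf Cl K) K)
    (hcα : 0 ≤ cα) (hdecay : ∀ j, αlev j ≤ cα * ε₁ * (((L : ℝ) ^ j)⁻¹) ^ 2)
    (hα₁lev : ∀ j, 0 ≤ α₁lev j ∧ α₁lev j ≤ cα₁ * ε₁ * (((L : ℝ) ^ (j + 1))⁻¹) ^ 2 * ((L : ℝ) ^ j)⁻¹)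
    (hreprU : ∀ K t, |t| ≤ l₀ → ∀ τ ∈ T K \ Bad K t, ∀ v ∈ Adm,
      f₁ K t τ v (yA K t τ v) = ∑ x ∈ pbox planes (M * L ^ K * L), eN (phiU (VA K t τ v) x) ∧
        g K t τ v (xA K t τ v) = ∑ y ∈ pbox planes (M * L ^ K), eN (psiU L (VA K t τ v) y))
    (hreprL : ∀ K t, |t| ≤ l₀ → ∀ τ ∈ T K \ Bad K t, ∀ v ∈ Adm,
      f₁ K t τ v (yB K t τ v) = ∑ x ∈ pbox planes (M * L ^ K * L), eN (phiU (VB K t τ v) x) ∧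
        g K t τ v (Q K t τ v (yB K t τ v)) = ∑ y ∈ pbox planes (M * L ^ K), eN (psiU L (VB K t τ v) y))
    (hε₁ : 0 ≤ ε₁) (hCl : 0 ≤ Cl) :
    (∀ K t, |t| ≤ l₀ → ∀ τ ∈ T K \ Bad K t, ∀ v ∈ Adm,
      f₁ K t τ v (yA K t τ v) - g K t τ v (xA K t τ v)
        ≤ (M : ℝ) ^ 4 * ((planes.card : ℝ) * cU ((Fintype.card n : ℝ) / 24) (cSZ L cα) (cOSC L cα₁) (cBCH L cα) ε₁
            * windowSum (((L : ℝ) ^ 2)⁻¹) ((L : ℝ) ^ 4) (jlogOf Cl K) K)) ∧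
    (∀ K t, |t| ≤ l₀ → ∀ τ ∈ T K \ Bad K t, ∀ v ∈ Adm,
      g K t τ v (Q K t τ v (yB K t τ v)) - f₁ K t τ v (yB K t τ v)
        ≤ (M : ℝ) ^ 4 * ((planes.card : ℝ) * (cSZ L cα * cBCH L cα * ε₁ ^ 3 + cBCH L cα ^ 2 * ε₁ ^ 4 / 2
            + (Fintype.card n : ℝ) / 24 * (cSZ L cα ^ 4 * ε₁ ^ 4))
            * windowSum (((L : ℝ) ^ 2)⁻¹) ((L : ℝ) ^ 4) (jlogOf Cl K) K)) ∧
    (∀ K, 0 ≤ (planes.card : ℝ) * cU ((Fintype.card n : ℝ) / 24) (cSZ L cα) (cOSC L cα₁) (cBCH L cα) ε₁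
        * windowSum (((L : ℝ) ^ 2)⁻¹) ((L : ℝ) ^ 4) (jlogOf Cl K) K) ∧
    (∀ K, 0 ≤ (planes.card : ℝ) * (cSZ L cα * cBCH L cα * ε₁ ^ 3 + cBCH L cα ^ 2 * ε₁ ^ 4 / 2
        + (Fintype.card n : ℝ) / 24 * (cSZ L cα ^ 4 * ε₁ ^ 4))
        * windowSum (((L : ℝ) ^ 2)⁻¹) ((L : ℝ) ^ 4) (jlogOf Cl K) K) ∧
    Summable (fun K => (planes.card : ℝ) * cU ((Fintype.card n : ℝ) / 24) (cSZ L cα) (cOSC L cα₁) (cBCH L cα) ε₁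
        * windowSum (((L : ℝ) ^ 2)⁻¹) ((L : ℝ) ^ 4) (jlogOf Cl K) K) ∧
    Summable (fun K => (planes.card : ℝ) * (cSZ L cα * cBCH L cα * ε₁ ^ 3 + cBCH L cα ^ 2 * ε₁ ^ 4 / 2
        + (Fintype.card n : ℝ) / 24 * (cSZ L cα ^ 4 * ε₁ ^ 4))
        * windowSum (((L : ℝ) ^ 2)⁻¹) ((L : ℝ) ^ 4) (jlogOf Cl K) K) := by
  have hM0 : 0 < M := by omega
  have hL0 : 0 < L := by omega
  have hL1 : 1 ≤ L := by omega
  have hLr : (1 : ℝ) < L := by exact_mod_cast (lt_of_lt_of_le one_lt_two hL)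
  have h2L : ∀ K, 2 * L ≤ M * L ^ K * L := fun K =>
    Nat.mul_le_mul_right L (le_trans hM (Nat.le_mul_of_pos_right M (pow_pos hL0 K)))
  have hhalf : ∀ j, αlev j ≤ 1 / 2 := fun j => half_of_smallness hL1 (hαlev j).2
  obtain ⟨hw, hrow, hcol, hNf, hNc⟩ := kernel_tower_geometric M L hM0 hL0 planes
  have hρ := rho_le_of_decay L (fun j => (hαlev j).1) hdecay
  have hω : ∀ j, 0 ≤ 4 * ((4 : ℕ) : ℝ) * (L : ℝ) * α₁lev j ∧
      4 * ((4 : ℕ) : ℝ) * (L : ℝ) * α₁lev j ≤ cOSC L cα₁ * ε₁ * (((L : ℝ) ^ (j + 1))⁻¹) ^ 2 * ((L : ℝ) ^ j)⁻¹ :=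
    fun j => ⟨by have h0 := (hα₁lev j).1; positivity,
      calc 4 * ((4 : ℕ) : ℝ) * (L : ℝ) * α₁lev j = 16 * (L : ℝ) * α₁lev j := by push_cast; ring
        _ ≤ 16 * (L : ℝ) * (cα₁ * ε₁ * (((L : ℝ) ^ (j + 1))⁻¹) ^ 2 * ((L : ℝ) ^ j)⁻¹) :=
            mul_le_mul_of_nonneg_left (hα₁lev j).2 (by positivity)
        _ = cOSC L cα₁ * ε₁ * (((L : ℝ) ^ (j + 1))⁻¹) ^ 2 * ((L : ℝ) ^ j)⁻¹ := by unfold cOSC; ring⟩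
  exact interpolation_averaging_of_levels (V := ↥(uN n)) (e := eN) (q₄ := (Fintype.card n : ℝ) / 24)
    (vol := (M : ℝ) ^ 4) (n₀ := (planes.card : ℝ)) (c₁ := cSZ L cα) (c₂ := cOSC L cα₁) (c₃ := cBCH L cα)
    (sz := fun j => 2 * αlev j) (ω := fun j => 4 * ((4 : ℕ) : ℝ) * (L : ℝ) * α₁lev j)
    (Pf := fun K => pbox planes (M * L ^ K * L)) (Pc := fun K => pbox planes (M * L ^ K))
    (w := fun K => pker (M * L ^ K * L) L)
    (φA := fun K t τ v x => phiU (VA K t τ v) x) (ψA := fun K t τ v y => psiU L (VA K t τ v) y)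
    (ΦA := fun K t τ v y x => PhiU (M * L ^ K * L) L (VA K t τ v) y x)
    (φB := fun K t τ v x => phiU (VB K t τ v) x) (ψB := fun K t τ v y => psiU L (VB K t τ v) y)
    (ΦB := fun K t τ v y x => PhiU (M * L ^ K * L) L (VB K t τ v) y x)
    (lvlA := lvlA) (lvlB := lvlB) (lvlBf := lvlBf)
    (ρb := fun j => 280 * (320 * (L : ℝ) ^ 2 * αlev j) ^ 2)
    eN_sandwich (by positivity) hLr hw hrow hcol (Nat.cast_nonneg _) (by positivity)
    (fun K => (hNf K).le) (fun K => (hNc K).le) hreprU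
    (fun K t ht τ hτ v hv y _ x _ => norm_PhiU _ L (hA K t ht τ hτ v hv).1 (hA K t ht τ hτ v hv).2.1 y x)
    hwinA
    (fun K t ht τ hτ v hv y hy =>
      bch_PhiU_local _ L planes hplanes (hA K t ht τ hτ v hv).1 hL1 (h2L K) (hαlev _).1 (hαlev _).2 y
        (Finset.mem_product.1 hy).1 ((hA K t ht τ hτ v hv).2.2 y hy))
    (fun K t ht τ hτ v hv y hy x _ hpos =>
      norm_phiU_le_window_local (hA K t ht τ hτ v hv).2.1 y x (hplanes y.1 (Finset.mem_product.1 hy).1) (hhalf _)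
        (fun z hz => (hA K t ht τ hτ v hv).2.2 y hy z y.1.1 y.1.2 (hplanes y.1 (Finset.mem_product.1 hy).1) hz) hpos)
    (fun K t ht τ hτ v hv y hy x _ x' _ hpos hpos' =>
      norm_PhiU_sub_PhiU_local (M * L ^ K * L) L hL1 (hA K t ht τ hτ v hv).1 (hα₁lev _).1 y x x'
        (hplanes y.1 (Finset.mem_product.1 hy).1) (hAosc K t ht τ hτ v hv y hy) hpos hpos')
    hreprL
    (fun K t ht τ hτ v hv y _ x _ => norm_PhiU _ L (hB K t ht τ hτ v hv).1 (hB K t ht τ hτ v hv).2.1 y x)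
    hwinB hwinBf
    (fun K t ht τ hτ v hv y hy =>
      bch_PhiU_local _ L planes hplanes (hB K t ht τ hτ v hv).1 hL1 (h2L K) (hαlev _).1 (hαlev _).2 y
        (Finset.mem_product.1 hy).1 ((hB K t ht τ hτ v hv).2.2 y hy))
    (fun K t ht τ hτ v hv y hy x _ hpos =>
      norm_phiU_le_window_local (hB K t ht τ hτ v hv).2.1 y x (hplanes y.1 (Finset.mem_product.1 hy).1) (hhalf _)
        (fun z hz => (hB K t ht τ hτ v hv).2.2 y hy z y.1.1 y.1.2 (hplanes y.1 (Finset.mem_product.1 hy).1) hz) hpos)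
    (fun K t ht τ hτ v hv x hx => norm_phiU_le_local x (hhalf _) (hBf K t ht τ hτ v hv x hx))
    (cSZ_nonneg L hcα) (cBCH_nonneg L cα) hε₁ hCl (size_le_of_decay L hL1 (fun j => (hαlev j).1) hdecay) hω hρ

end Capstone
/-! ## §6 The good-class half with `Summable δ⁗` for G = U(N) Wilson terms from LEVEL-GRADED LOCAL regularity -/

section Ledger
variable {n : Type*} [Fintype n] [DecidableEq n] [Nonempty n]
variable {C : T4BoundaryCarrier.Carriers} {ι : Type} [MeasurableSpace ι] {σ : Type*} [DecidableEq σ] {l₀ vol : ℝ}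
  {T : ℕ → Finset σ} {Bad : ℕ → ℝ → Finset σ} {A B : ℕ → ℝ → σ → ℝ} {μ : ℕ → ℝ → σ → Measure ι}
  {fac bfac rfac : ℕ → ℝ → σ → Finset C.Dom} {Adm : Set ι} {EA : Functional C.toCarriers C.BgA}
  {EB : Functional C.toCarriers C.BgB} {BA : BFunctional C C.BgA} {BB : BFunctional C C.BgB}
  {RA : Functional C.toCarriers C.BgA} {RB : Functional C.toCarriers C.BgB}
  {κ θ' Cr EB₀ CrR R₁ b β' w₀ : ℝ} {κ₀ : ℕ} {gA gB : ℕ → ℕ → ℝ} {gfA gfB : ℕ → ℝ} {gsA gsB : ℕ → ℕ → ℝ}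
  {uA : ℕ → ι → C.BgA} {uB : ℕ → ι → C.BgB} {oneA : C.BgA} {oneB : C.BgB}
  {pend : ℕ → ℝ → σ → ι → C.Fl} {nA nB aA aB wA wB γA γB : ℕ → ℝ → σ → ι → ℝ} {qA qB : ℕ → ℝ}
  {κ₁ S : ℕ → ℝ → σ → ℕ → ℝ} {cW RW : ℕ → ℝ → σ → ℝ} {rw sw rγ zA zB c₀ : ℕ → ℝ} {Cw E a Λ Cl : ℝ}

/-- **THE GOOD-CLASS HALF WITH `Summable δ⁗` FOR G = U(N) WILSON TERMS, THE ACTION KIND FROM LEVEL-GRADED LOCAL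
REGULARITY UNDER THE WINDOW CLAUSE.**  `T4TermwiseChainUN.goodClause_summable_UN` with its UNIFORM per-scale
background axioms (44) `hA hB`, (44∇) `hAosc`, smallness `hαK` and decays `hdecay hα₁K` REPLACED by their
LEVEL-GRADED LOCAL forms: level maps `lvlA lvlB lvlBf`, window clauses `hwinA hwinB hwinBf` (`RecentOnly …
(jlogOf Cl K) K`, the cut of (B-win)), LOCAL (44) on the window box `Δ(p′_y)` with the constant `αlev (lvl y)` of
the window's level (`hA hB`; `hBf` at run B's fine plaquettes), LOCAL (44∇) `hAosc` with `α₁lev (lvl y)`, per-level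
smallness `hαlev` and decays `hdecay hα₁lev`.  Every other ledger binder of generation 9 is carried BY NAME and
VERBATIM — the flow window (0.31) of [Balaban1987RG1] in `h031A`/`h031B`, (repr) `hreprU hreprL`, `hMvol : M⁴ ≤ vol`,
the upstream kinds.  OUTPUT: the good clause with generation 9's `δ⁗` whose action-kind share is the WINDOWED
majorant `w₀·(#planes·C_U·windowSum L⁻² L⁴ (jlogOf Cl K) K + #planes·C_L·(same))`, `N = Fintype.card n`, and
`Summable δ⁗`.  No print is quoted; nothing printed is asserted; NOT NE7, NOT Clay. [folklore] -/
theorem goodClause_summable_UN_levels {Y YA : Type*} {Sfib : ℕ → ℝ → σ → ι → Set Y}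
    {SfibA : ℕ → ℝ → σ → ι → Set YA} {g : ℕ → ℝ → σ → ι → YA → ℝ} {f₁ : ℕ → ℝ → σ → ι → Y → ℝ}
    {Q : ℕ → ℝ → σ → ι → Y → YA} {yA yB : ℕ → ℝ → σ → ι → Y} {xA : ℕ → ℝ → σ → ι → YA}
    (M L : ℕ) (hMtwo : 2 ≤ M) (hLtwo : 2 ≤ L) (planes : Finset (Fin 4 × Fin 4))
    (hplanes : ∀ P ∈ planes, P.1 ≠ P.2)
    (VA VB : ℕ → ℝ → σ → ι → (B7Prop1Explicit.Site 4 → Fin 4 → (Matrix n n ℂ)ˣ))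
    (lvlA lvlB lvlBf : ℕ → ℝ → σ → ι → (Fin 4 × Fin 4) × B7Prop1Explicit.Site 4 → ℕ)
    {αlev α₁lev : ℕ → ℝ} {cα cα₁ ε₁ : ℝ}
    (hUR : ∀ K, URateUpTo K EA EB (gA K) (gB K) (uA K) (uB K) Adm Cr θ' κ) (hCr : 0 ≤ Cr)
    (hθ'0 : 0 < θ') (hθ'1 : θ' < 1) (hθ'Λ : θ' ≤ Λ) (hΛ1 : 1 ≤ Λ) (hCl : 0 ≤ Cl)
    (hURB : ∀ b ∈ C.admFl, ∀ K, URateUpTo K (atFl BA b) (atFl BB b) (gA K) (gB K) (uA K) (uB K) Adm EB₀ θ' κ)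
    (hEB₀ : 0 ≤ EB₀)
    (hURR : ∀ K, URateUpTo K RA RB (gA K) (gB K) (uA K) (uB K) Adm CrR θ' κ) (hCrR : 0 ≤ CrR)
    (hfmtA : ∀ K t τ, A K t τ = ∫ v, (∏ X ∈ fac K t τ,
      Real.exp (EA (gA K) (uA K v) X - EA (gA K) oneA X)) *
        ((∏ X ∈ bfac K t τ, Real.exp (BA (gA K) (uA K v) (pend K t τ v) X)) * nA K t τ v * qA K *
          ((∏ X ∈ rfac K t τ, Real.exp (RA (gA K) (uA K v) X - RA (gA K) oneA X)) * (Real.exp (-aA K t τ v) * wA K t τ v)))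
          ∂(μ K t τ))
    (hfmtB : ∀ K t τ, B K t τ = ∫ v, (∏ X ∈ fac K t τ,
      Real.exp (EB (gB K) (uB K v) X - EB (gB K) oneB X)) *
        ((∏ X ∈ bfac K t τ, Real.exp (BB (gB K) (uB K v) (pend K t τ v) X)) * nB K t τ v * qB K *
          ((∏ X ∈ rfac K t τ, Real.exp (RB (gB K) (uB K v) X - RB (gB K) oneB X)) * (Real.exp (-aB K t τ v) * wB K t τ v)))
          ∂(μ K t τ))
    (hint : ∀ K t, |t| ≤ l₀ → ∀ τ ∈ T K \ Bad K t,
      Integrable (fun v => (∏ X ∈ fac K t τ, Real.exp (EA (gA K) (uA K v) X - EA (gA K) oneA X)) *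
        ((∏ X ∈ bfac K t τ, Real.exp (BA (gA K) (uA K v) (pend K t τ v) X)) * nA K t τ v * qA K *
          ((∏ X ∈ rfac K t τ, Real.exp (RA (gA K) (uA K v) X - RA (gA K) oneA X)) * (Real.exp (-aA K t τ v) * wA K t τ v))))
          (μ K t τ) ∧
      Integrable (fun v => (∏ X ∈ fac K t τ, Real.exp (EB (gB K) (uB K v) X - EB (gB K) oneB X)) *
        ((∏ X ∈ bfac K t τ, Real.exp (BB (gB K) (uB K v) (pend K t τ v) X)) * nB K t τ v * qB K *
          ((∏ X ∈ rfac K t τ, Real.exp (RB (gB K) (uB K v) X - RB (gB K) oneB X)) * (Real.exp (-aB K t τ v) * wB K t τ v))))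
          (μ K t τ))
    (hsc : ∀ K t, |t| ≤ l₀ → ∀ τ ∈ T K \ Bad K t, ∀ X ∈ fac K t τ, C.scale X ≤ K)
    (hoff : ∀ K t, |t| ≤ l₀ → ∀ τ ∈ T K \ Bad K t, ∀ v, v ∉ Adm →
      (∏ X ∈ fac K t τ, Real.exp (EA (gA K) (uA K v) X - EA (gA K) oneA X)) *
        ((∏ X ∈ bfac K t τ, Real.exp (BA (gA K) (uA K v) (pend K t τ v) X)) * nA K t τ v * qA K *
          ((∏ X ∈ rfac K t τ, Real.exp (RA (gA K) (uA K v) X - RA (gA K) oneA X)) * (Real.exp (-aA K t τ v) * wA K t τ v)))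
          = 0 ∧
      (∏ X ∈ fac K t τ, Real.exp (EB (gB K) (uB K v) X - EB (gB K) oneB X)) *
        ((∏ X ∈ bfac K t τ, Real.exp (BB (gB K) (uB K v) (pend K t τ v) X)) * nB K t τ v * qB K *
          ((∏ X ∈ rfac K t τ, Real.exp (RB (gB K) (uB K v) X - RB (gB K) oneB X)) * (Real.exp (-aB K t τ v) * wB K t τ v)))
          = 0)
    (hS : ∀ K t, |t| ≤ l₀ → ∀ τ ∈ T K \ Bad K t, ∀ v ∈ Adm, ∀ j ≤ K,
      |(∑ X ∈ fac K t τ with C.scale X = j,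
          (Real.log (Real.exp (EB (gB K) (uB K v) X - EB (gB K) oneB X))
            - Real.log (Real.exp (EA (gA K) (uA K v) X - EA (gA K) oneA X)))) - κ₁ K t τ j| ≤ S K t τ j)
    (hM : ∀ K t, |t| ≤ l₀ → ∀ τ ∈ T K \ Bad K t,
      Multiplicity (fac K t τ) C.scale (fun X => Real.exp (-(κ * C.d X))) Cw vol Λ K)
    (hwit : ∀ K, ∃ v₁ ∈ Adm, uA K v₁ = oneA ∧ uB K v₁ = oneB)
    (hvol : 0 ≤ vol) (hE : 0 ≤ E) (ha0 : 0 < a) (ha1 : a < 1)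
    (hSle : ∀ K t, |t| ≤ l₀ → ∀ τ ∈ T K \ Bad K t, ∀ j ≤ K, S K t τ j ≤ vol * (E * a ^ (K - j)))
    (hpend : ∀ K t, |t| ≤ l₀ → ∀ τ ∈ T K \ Bad K t, ∀ v ∈ Adm, pend K t τ v ∈ C.admFl)
    (hBwin : ∀ K t, |t| ≤ l₀ → ∀ τ ∈ T K \ Bad K t, RecentOnly (bfac K t τ) C.scale (jlogOf Cl K) K)
    (hMB : ∀ K t, |t| ≤ l₀ → ∀ τ ∈ T K \ Bad K t,
      Multiplicity (bfac K t τ) C.scale (fun X => Real.exp (-(κ * C.d X))) Cw vol Λ K)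
    (hnpos : ∀ K t, |t| ≤ l₀ → ∀ τ ∈ T K \ Bad K t, ∀ v ∈ Adm, 0 < nA K t τ v ∧ 0 < nB K t τ v)
    (hzA : ∀ K t, |t| ≤ l₀ → ∀ τ ∈ T K \ Bad K t, ∀ v ∈ Adm, |Real.log (nA K t τ v)| ≤ vol * zA K)
    (hzB : ∀ K t, |t| ≤ l₀ → ∀ τ ∈ T K \ Bad K t, ∀ v ∈ Adm, |Real.log (nB K t τ v)| ≤ vol * zB K)
    (hzAs : Summable zA) (hzBs : Summable zB)
    (hq : ∀ K, 0 < qA K ∧ 0 < qB K)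
    -- the 𝐑-kind: scales, multiplicity, one-run slice sizes, the flow window of both coupling tables
    (hrsc : ∀ K t, |t| ≤ l₀ → ∀ τ ∈ T K \ Bad K t, ∀ X ∈ rfac K t τ, C.scale X ≤ K)
    (hMR : ∀ K t, |t| ≤ l₀ → ∀ τ ∈ T K \ Bad K t,
      Multiplicity (rfac K t τ) C.scale (fun X => Real.exp (-(κ * C.d X))) Cw vol Λ K)
    (hRSA : ∀ K t, |t| ≤ l₀ → ∀ τ ∈ T K \ Bad K t, ∀ v ∈ Adm, ∀ j ≤ K,
      |∑ X ∈ rfac K t τ with C.scale X = j, (RA (gA K) (uA K v) X - RA (gA K) oneA X)| ≤ vol * (R₁ * gsA K j ^ κ₀))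
    (hRSB : ∀ K t, |t| ≤ l₀ → ∀ τ ∈ T K \ Bad K t, ∀ v ∈ Adm, ∀ j ≤ K,
      |∑ X ∈ rfac K t τ with C.scale X = j, (RB (gB K) (uB K v) X - RB (gB K) oneB X)| ≤ vol * (R₁ * gsB K j ^ κ₀))
    (hb : 0 < b) (h031A : ∀ K, Step.Discrete031 b β' K (gfA K) (gsA K))
    (h031B : ∀ K, Step.Discrete031 b β' K (gfB K) (gsB K)) (hgsA : ∀ K k, k ≤ K → 0 ≤ gsA K k)
    (hgsB : ∀ K k, k ≤ K → 0 ≤ gsB K k) (hR₁ : 0 ≤ R₁) (hκ₀ : 4 < κ₀)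
    -- the ACTION kind from ONE CLASSICAL STEP: (min-A) (Q) (lift) (min-B) (act) (U) (L) (γ)
    (hminA : ∀ K t, |t| ≤ l₀ → ∀ τ ∈ T K \ Bad K t, ∀ v ∈ Adm, IsMinOn (g K t τ v) (SfibA K t τ v) (xA K t τ v))
    (hQ : ∀ K t, |t| ≤ l₀ → ∀ τ ∈ T K \ Bad K t, ∀ v ∈ Adm, Set.MapsTo (Q K t τ v) (Sfib K t τ v) (SfibA K t τ v))
    (hlift : ∀ K t, |t| ≤ l₀ → ∀ τ ∈ T K \ Bad K t, ∀ v ∈ Adm,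
      yA K t τ v ∈ Sfib K t τ v ∧ Q K t τ v (yA K t τ v) = xA K t τ v)
    (hminB : ∀ K t, |t| ≤ l₀ → ∀ τ ∈ T K \ Bad K t, ∀ v ∈ Adm,
      yB K t τ v ∈ Sfib K t τ v ∧ IsMinOn (f₁ K t τ v) (Sfib K t τ v) (yB K t τ v))
    (hact : ∀ K t, |t| ≤ l₀ → ∀ τ ∈ T K \ Bad K t, ∀ v ∈ Adm,
      aA K t τ v = w₀ * g K t τ v (xA K t τ v) + γA K t τ v ∧
        aB K t τ v = w₀ * f₁ K t τ v (yB K t τ v) + γB K t τ v)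
    (hw₀ : 0 ≤ w₀)
    -- (U)(L) PRODUCED for G = U(N) Wilson terms from LEVEL-GRADED LOCAL regularity under the WINDOW CLAUSE
    -- (`interpolation_averaging_UN_levels`): (repr) `hreprU hreprL`; unitarity + periodicity + LOCAL (44) on the window
    -- boxes at the window's level `hA hB`, (44) at the fine plaquettes of run B `hBf`, LOCAL (44∇) `hAosc`; the window
    -- clauses `hwinA hwinB hwinBf`; per-level smallness `hαlev` and decays `hdecay` `hα₁lev`; `hcα hε₁`; `M⁴ ≤ vol`
    (hαlev : ∀ j, 0 ≤ αlev j ∧ 20480 * (L : ℝ) ^ 2 * αlev j ≤ 1)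
    (hA : ∀ K t, |t| ≤ l₀ → ∀ τ ∈ T K \ Bad K t, ∀ v ∈ Adm,
      (∀ x κ, VA K t τ v x κ ∈ unitaryUnits (Matrix n n ℂ)) ∧ IsPeriodic (M * L ^ K * L) (VA K t τ v) ∧
        ∀ y ∈ pbox planes (M * L ^ K), ∀ (x : B7Prop1Explicit.Site 4) (κ κ' : Fin 4), κ ≠ κ' →
          PlaqIn ((L : ℤ) • y.2) (deltaHi L ((L : ℤ) • y.2) y.1.1 y.1.2) (x, κ, κ') →
          ‖((hol (VA K t τ v) x (plaqWord κ κ') : (Matrix n n ℂ)ˣ) : Matrix n n ℂ) - 1‖ ≤ αlev (lvlA K t τ v y))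
    (hB : ∀ K t, |t| ≤ l₀ → ∀ τ ∈ T K \ Bad K t, ∀ v ∈ Adm,
      (∀ x κ, VB K t τ v x κ ∈ unitaryUnits (Matrix n n ℂ)) ∧ IsPeriodic (M * L ^ K * L) (VB K t τ v) ∧
        ∀ y ∈ pbox planes (M * L ^ K), ∀ (x : B7Prop1Explicit.Site 4) (κ κ' : Fin 4), κ ≠ κ' →
          PlaqIn ((L : ℤ) • y.2) (deltaHi L ((L : ℤ) • y.2) y.1.1 y.1.2) (x, κ, κ') →
          ‖((hol (VB K t τ v) x (plaqWord κ κ') : (Matrix n n ℂ)ˣ) : Matrix n n ℂ) - 1‖ ≤ αlev (lvlB K t τ v y))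
    (hBf : ∀ K t, |t| ≤ l₀ → ∀ τ ∈ T K \ Bad K t, ∀ v ∈ Adm, ∀ x ∈ pbox planes (M * L ^ K * L),
      ‖((hol (VB K t τ v) x.2 (plaqWord x.1.1 x.1.2) : (Matrix n n ℂ)ˣ) : Matrix n n ℂ) - 1‖ ≤ αlev (lvlBf K t τ v x))
    (hAosc : ∀ K t, |t| ≤ l₀ → ∀ τ ∈ T K \ Bad K t, ∀ v ∈ Adm, ∀ y ∈ pbox planes (M * L ^ K),
      ∀ (z : B7Prop1Explicit.Site 4) (κ : Fin 4), InBox ((L : ℤ) • y.2) (deltaHi L ((L : ℤ) • y.2) y.1.1 y.1.2) z →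
        InBox ((L : ℤ) • y.2) (deltaHi L ((L : ℤ) • y.2) y.1.1 y.1.2) (z + e κ) →
        ‖((VA K t τ v z κ : (Matrix n n ℂ)ˣ) : Matrix n n ℂ) * phiM (VA K t τ v) y.1 (z + e κ)
            * (((VA K t τ v z κ)⁻¹ : (Matrix n n ℂ)ˣ) : Matrix n n ℂ) - phiM (VA K t τ v) y.1 z‖
          ≤ α₁lev (lvlA K t τ v y))
    (hwinA : ∀ K t, |t| ≤ l₀ → ∀ τ ∈ T K \ Bad K t, ∀ v ∈ Adm,
      RecentOnly (pbox planes (M * L ^ K)) (lvlA K t τ v) (jlogOf Cl K) K)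
    (hwinB : ∀ K t, |t| ≤ l₀ → ∀ τ ∈ T K \ Bad K t, ∀ v ∈ Adm,
      RecentOnly (pbox planes (M * L ^ K)) (lvlB K t τ v) (jlogOf Cl K) K)
    (hwinBf : ∀ K t, |t| ≤ l₀ → ∀ τ ∈ T K \ Bad K t, ∀ v ∈ Adm,
      RecentOnly (pbox planes (M * L ^ K * L)) (lvlBf K t τ v) (jlogOf Cl K) K)
    (hcα : 0 ≤ cα) (hdecay : ∀ j, αlev j ≤ cα * ε₁ * (((L : ℝ) ^ j)⁻¹) ^ 2)
    (hα₁lev : ∀ j, 0 ≤ α₁lev j ∧ α₁lev j ≤ cα₁ * ε₁ * (((L : ℝ) ^ (j + 1))⁻¹) ^ 2 * ((L : ℝ) ^ j)⁻¹)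
    (hreprU : ∀ K t, |t| ≤ l₀ → ∀ τ ∈ T K \ Bad K t, ∀ v ∈ Adm,
      f₁ K t τ v (yA K t τ v) = ∑ x ∈ pbox planes (M * L ^ K * L), eN (phiU (VA K t τ v) x) ∧
        g K t τ v (xA K t τ v) = ∑ y ∈ pbox planes (M * L ^ K), eN (psiU L (VA K t τ v) y))
    (hreprL : ∀ K t, |t| ≤ l₀ → ∀ τ ∈ T K \ Bad K t, ∀ v ∈ Adm,
      f₁ K t τ v (yB K t τ v) = ∑ x ∈ pbox planes (M * L ^ K * L), eN (phiU (VB K t τ v) x) ∧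
        g K t τ v (Q K t τ v (yB K t τ v)) = ∑ y ∈ pbox planes (M * L ^ K), eN (psiU L (VB K t τ v) y))
    (hε₁ : 0 ≤ ε₁) (hMvol : ((M : ℝ)) ^ 4 ≤ vol)
    (hγ : ∀ K t, |t| ≤ l₀ → ∀ τ ∈ T K \ Bad K t, ∀ v ∈ Adm, |γB K t τ v - γA K t τ v| ≤ vol * rγ K)
    (hrγ : Summable rγ)
    -- the residual kind after generation 8: (R-w) radii about a centre `cW`, (W-w) the WITNESS log-ratio centred
    (hwpos : ∀ K t, |t| ≤ l₀ → ∀ τ ∈ T K \ Bad K t, ∀ v ∈ Adm, 0 < wA K t τ v ∧ 0 < wB K t τ v)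
    (hRw : ∀ K t, |t| ≤ l₀ → ∀ τ ∈ T K \ Bad K t, ∀ v ∈ Adm,
      |Real.log (wB K t τ v) - Real.log (wA K t τ v) - cW K t τ| ≤ RW K t τ)
    (hRRw : ∀ K t, |t| ≤ l₀ → ∀ τ ∈ T K \ Bad K t, RW K t τ ≤ vol * rw K) (hrw : Summable rw)
    (hWw : ∀ K t, |t| ≤ l₀ → ∀ τ ∈ T K \ Bad K t, ∀ v ∈ Adm, uA K v = oneA → uB K v = oneB →
      |Real.log (wB K t τ v) - Real.log (wA K t τ v) - c₀ K| ≤ vol * sw K)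
    (hsw : Summable sw) :
    GoodClause l₀ vol T A B Bad
        (fun K => (max Cw 1 * ((E + Cr) * ∑ x ∈ antidiagonal K, min (a ^ x.2) (θ' ^ x.1 * Λ ^ x.2))
            + (EB₀ * Cw * windowSum θ' Λ (jlogOf Cl K) K + (zA K + zB K)
              + (max (2 * Cw) 1 * ((∑ p ∈ antidiagonal K, min (R₁ * gsA K p.1 ^ κ₀) (CrR * θ' ^ p.1 * Λ ^ p.2))
                  + ∑ p ∈ antidiagonal K, min (R₁ * gsB K p.1 ^ κ₀) (CrR * θ' ^ p.1 * Λ ^ p.2))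
                + (w₀ * ((planes.card : ℝ) * cU ((Fintype.card n : ℝ) / 24) (cSZ L cα) (cOSC L cα₁) (cBCH L cα) ε₁
                      * windowSum (((L : ℝ) ^ 2)⁻¹) ((L : ℝ) ^ 4) (jlogOf Cl K) K
                    + (planes.card : ℝ) * (cSZ L cα * cBCH L cα * ε₁ ^ 3 + cBCH L cα ^ 2 * ε₁ ^ 4 / 2
                        + (Fintype.card n : ℝ) / 24 * (cSZ L cα ^ 4 * ε₁ ^ 4))
                      * windowSum (((L : ℝ) ^ 2)⁻¹) ((L : ℝ) ^ 4) (jlogOf Cl K) K)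
                  + rγ K + rw K))))
          + (max Cw 1 * ((E + Cr) * ∑ x ∈ antidiagonal K, min (a ^ x.2) (θ' ^ x.1 * Λ ^ x.2)) + (rw K + sw K))) ∧
      Summable (fun K => (max Cw 1 * ((E + Cr) * ∑ x ∈ antidiagonal K, min (a ^ x.2) (θ' ^ x.1 * Λ ^ x.2))
            + (EB₀ * Cw * windowSum θ' Λ (jlogOf Cl K) K + (zA K + zB K)
              + (max (2 * Cw) 1 * ((∑ p ∈ antidiagonal K, min (R₁ * gsA K p.1 ^ κ₀) (CrR * θ' ^ p.1 * Λ ^ p.2))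
                  + ∑ p ∈ antidiagonal K, min (R₁ * gsB K p.1 ^ κ₀) (CrR * θ' ^ p.1 * Λ ^ p.2))
                + (w₀ * ((planes.card : ℝ) * cU ((Fintype.card n : ℝ) / 24) (cSZ L cα) (cOSC L cα₁) (cBCH L cα) ε₁
                      * windowSum (((L : ℝ) ^ 2)⁻¹) ((L : ℝ) ^ 4) (jlogOf Cl K) K
                    + (planes.card : ℝ) * (cSZ L cα * cBCH L cα * ε₁ ^ 3 + cBCH L cα ^ 2 * ε₁ ^ 4 / 2
                        + (Fintype.card n : ℝ) / 24 * (cSZ L cα ^ 4 * ε₁ ^ 4))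
                      * windowSum (((L : ℝ) ^ 2)⁻¹) ((L : ℝ) ^ 4) (jlogOf Cl K) K)
                  + rγ K + rw K))))
          + (max Cw 1 * ((E + Cr) * ∑ x ∈ antidiagonal K, min (a ^ x.2) (θ' ^ x.1 * Λ ^ x.2)) + (rw K + sw K))) := by
  obtain ⟨hU, hLd, hU0, hL0, hUs, hLs⟩ := interpolation_averaging_UN_levels (l₀ := l₀) (T := T) (Bad := Bad)
    (Adm := Adm) (g := g) (f₁ := f₁) (Q := Q) (yA := yA) (yB := yB) (xA := xA) M L hMtwo hLtwo planes hplanes VA VB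
    lvlA lvlB lvlBf hαlev hA hB hBf hAosc hwinA hwinB hwinBf hcα hdecay hα₁lev hreprU hreprL hε₁ hCl
  exact goodClause_summable_of_kindsRA_lift hUR hCr hθ'0 hθ'1 hθ'Λ hΛ1 hCl hURB hEB₀ hURR hCrR hfmtA hfmtB hint hsc
    hoff hS hM hwit hvol hE ha0 ha1 hSle hpend hBwin hMB hnpos hzA hzB hzAs hzBs hq hrsc hMR hRSA hRSB hb h031A h031B
    hgsA hgsB hR₁ hκ₀ hminA hQ hlift hminB hact hw₀
    (fun K t ht τ hτ v hv => (hU K t ht τ hτ v hv).trans (mul_le_mul_of_nonneg_right hMvol (hU0 K)))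
    (fun K t ht τ hτ v hv => (hLd K t ht τ hτ v hv).trans (mul_le_mul_of_nonneg_right hMvol (hL0 K)))
    hU0 hL0 hUs hLs hγ hrγ hwpos hRw hRRw hrw hWw hsw

end Ledger
end Summit.QuantumFields.BalabanUV.T4Continuum.TermwiseLocal
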